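import Mathlib.Data.Nat.Factorial.BigOperators
import Literature.IUT.HodgeTheaters.PMBaseBridges
import Mathlib.CategoryTheory.SingleObj
import Literature.IUT.HodgeTheaters.PMBaseKitModel

/-!
# [IUTchI] §6, Propositions 6.7–6.9 and Corollary 6.10: `Θ`-bridges from `Θ^±`-bridges, symmetries, processions, étale picture

Mochizuki, *Inter-universal Teichmüller theory I*, §6: Proposition 6.7 p. 167, Proposition 6.8
(i)–(iii) pp. 167–168, Proposition 6.9 (i)–(iii) pp. 169–170, Corollary 6.10 (i)–(iv) pp. 170–172,
kurims manuscript (May 2020) ([IUTchI] Prop 6.7-Cor 6.10 pp.167-172) [claim: Mochizuki2012, status: disputed].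

These four results are bookkeeping over the multiplicative theory of §4 ([IUTchI] Def 4.1 (iii),
(iv): `𝒟^⊢`-prime-strips and mono-analyticization; Example 4.4: the model `𝒟-Θ`-bridge; Def 4.6 (ii):
`𝒟-Θ`-bridges; Def 4.10: processions; Prop 4.11; Cor 4.12), which is abc-iut-L5-t3's slice. The §4
inputs consumed here are packaged as the interface `MultKit K` (TODO-merge:abc-iut-L5-t3), each field
quoting print; over it we type:

* Prop 6.7: the "functorial algorithm" `𝒟-Θ^±`-bridge `↦` `𝒟-Θ`-bridge `†𝔇_{T^⋇} → †𝔇_>` (construction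
  `DThetaPMBridge.thetaBridgeData` + named statement `ThetaBridgeAlgorithm`);
* Prop 6.8 (i) `𝔽_l^{⋊±}`-symmetry of the underlying `𝒟-Θ^{ell}`-bridge (doubly transitive on `T`); (ii)
  the `l^±`-capsule `†𝔇_{|T|}` with its `𝔖_{l^±}`-symmetry — PROVED (any two constituents of any
  capsules of `𝒟`-prime-strips are isomorphic); (iii) its mono-analyticization `†𝔇^⊢_{|T|}` — PROVED
  likewise;
* Prop 6.9 (i), (ii): the `l^±`-processions `Prc(†𝔇_T)`, `Prc(†𝔇^⊢_T)` via the nested subsets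
  `S^±_1 ⊆ … ⊆ S^±_t = {0, 1, …, t−1} ⊆ … ⊆ S^±_{l^±} = |𝔽_l|` and the count "reduced to an
  indeterminacy consisting of a total of `l^±!` possibilities" (vs `(l^±)^{l^±}`);
* Cor 6.10 (i) the `𝒟-Θ^{±ell}`-link `†𝔇^⊢_> ⥲ ‡𝔇^⊢_>` (full poly-isomorphism), (ii) infinite chains and
  the mono-analytic core, (iii) the étale-picture with its "arbitrary permutation symmetries among
  the spokes".

Prop 6.9 (iii) and Cor 6.10 (iv) (compatibility with Prop 4.11 / Cor 4.12 "relative to the functor of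
Proposition 6.7") are typed with abc-iut-L5-t3's functors as PARAMETERS (`ProcessionCompat`,
`CoreCompat`), to be specialised when their §4 file lands.
-/

namespace Literature.IUT.HodgeTheaters

open CategoryTheory

universe u

namespace PMBaseKit

variable {l : ℕ} (K : PMBaseKit.{u} l)


/-! ### The §4 inputs (interface; TODO-merge:abc-iut-L5-t3) -/

/-- **The multiplicative (§4) inputs of §6** as an interface over the base kit
(TODO-merge:abc-iut-L5-t3, who types [IUTchI] §4): `𝒟^⊢`-prime-strips and mono-analyticization
([IUTchI] Def 4.1 (iii), (iv) p. 96), and the model `𝒟-Θ`-bridge of Example 4.4 (i), (ii) pp. 105–107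
at the bad places. ([IUTchI] Def 4.1 (iii)-(iv) p.96) [claim: Mochizuki2012, status: disputed] -/
structure MultKit where
  /-- the category of `𝒟^⊢`-prime-strips and their isomorphisms ("a mono-analytic base-prime-strip, or
  `𝒟^⊢`-prime-strip, … `†𝔇^⊢ = {†𝒟^⊢_v}_{v∈𝕍}` … (a) if `v ∈ 𝕍^non`, then `†𝒟^⊢_v` is a category which
  admits an equivalence `†𝒟^⊢_v ⥲ 𝒟^⊢_v` …; (b) if `v ∈ 𝕍^arc`, then `†𝒟^⊢_v` is an object of the
  category `𝕋𝕄^⊢`", [IUTchI] Def 4.1 (iii) p. 96) -/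
  DMono : Type u
  /-- category structure (isomorphisms of `𝒟^⊢`-prime-strips, Def 4.1 (iv)) -/
  [catDMono : Groupoid.{u} DMono]
  /-- mono-analyticization `†𝔇 ↦ †𝔇^⊢` ("to any `𝒟`-prime-strip `†𝔇` one may associate, in a natural
  way, a `𝒟^⊢`-prime-strip `†𝔇^⊢` — which we shall refer to as the mono-analyticization of `†𝔇` — by
  considering appropriate subcategories at the nonarchimedean primes, or by applying the
  construction of Example 3.4, (ii), at the archimedean primes", [IUTchI] Def 4.1 (iv) p. 96) -/
  mono : K.DStrip → DMono
  /-- functoriality of mono-analyticization on isomorphisms of `𝒟`-prime-strips -/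
  monoMap : ∀ {D₁ D₂ : K.DStrip}, D₁.Iso D₂ → (mono D₁ ⟶ mono D₂)
  /-- the model poly-morphisms `φ^Θ_{v_j} : 𝒟_{v_j} → 𝒟_{>,v}` of [IUTchI] Example 4.4 (i), (ii)
  pp. 105–107 at `v ∈ 𝕍^bad` ("the poly-morphisms described [via group-theoretic algorithms!] in
  Example 4.4, (i), (ii)", Prop 6.7 p. 167), indexed by `j ∈ 𝔽_l^⋇ = {1, …, l^⋇}` -/
  thetaPolyBad : ∀ (_j : Fin ((l - 1) / 2)) (v : K.V), v ∈ K.bad → Set (K.model v ⟶ K.model v)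

attribute [instance] MultKit.catDMono

/-- The data of a poly-morphism from a capsule of `𝒟`-prime-strips to a `𝒟`-prime-strip whose
constituents are arbitrary morphisms at each `v` — the shape of a `𝒟-Θ`-bridge `†φ^Θ_⋇ : †𝔇_J → †𝔇_>`
([IUTchI] Def 4.6 (ii) p. 111: "a poly-morphism — where `†𝔇_>` is a `𝒟`-prime-strip; `†𝔇_J = {†𝔇_j}_{j∈J}`
is a capsule of `𝒟`-prime-strips, indexed by a finite index set `J`"; the condition "such that there
exist isomorphisms `𝔇_> ⥲ †𝔇_>`, `𝔇_⋇ ⥲ †𝔇_J`, conjugation by which maps `φ^Θ_⋇ ↦ †φ^Θ_⋇`" is abc-iut-L5-t3's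
Def 4.6 (ii), TODO-merge). ([IUTchI] Def 4.6 (ii) p.111) [claim: Mochizuki2012, status: disputed] -/
structure DThetaBridgeData where
  /-- the finite index set `J` -/
  J : Type u
  /-- the capsule `†𝔇_J` -/
  capsule : J → K.DStrip
  /-- the `𝒟`-prime-strip `†𝔇_>` -/
  codomain : K.DStrip
  /-- the constituent poly-morphisms `†φ^Θ_{v_j} : †𝒟_{v_j} → †𝒟_{>,v}` -/
  poly : ∀ j v, Set ((capsule j).obj v ⟶ codomain.obj v)

/-! ### Proposition 6.7: `𝒟-Θ`-bridges associated to `𝒟-Θ^±`-bridges -/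

namespace DThetaPMBridge

variable {K} (B : K.DThetaPMBridge) (M : K.MultKit)

/-- The label `|t| ∈ |𝔽_l| = {0, 1, …, l^± − 1}` of a class `q ∈ |T|` "relative to the bijection
`|T| ⥲ |𝔽_l|` determined by the `𝔽_l^±`-group structure of `T`" ([IUTchI] Def 6.4 (i) p. 162; Prop 6.9 (i)
p. 169): the least natural representative of `±e(t)` for the chosen chart `e` (independent of the
chart, which changes `e(t)` at most by a sign). ([IUTchI] Prop 6.9 (i) p.169) [claim: Mochizuki2012, status: disputed] -/
noncomputable def absLabel (q : B.grpT.Abs) : ℕ :=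
  min (B.grpT.chart₀ (Quotient.out q)).val (-(B.grpT.chart₀ (Quotient.out q))).val

/-- For `l` odd, the label of a NONZERO class lies in `{1, …, l^⋇}`, `l^⋇ = (l − 1)/2` ([IUTchI] Def 6.4
(i) p. 162: "`T^⋇` … may be naturally identified with `𝔽_l^⋇`"). PROVED: `e ≠ 0` and `e + (−e) = l`.
([IUTchI] Def 6.4 (i) p.162) [claim: Mochizuki2012, status: disputed] -/
theorem absLabel_pos_le (hl : Odd l) (q : B.grpT.AbsStar) :
    1 ≤ B.absLabel q.1 ∧ B.absLabel q.1 ≤ (l - 1) / 2 := by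
  haveI : NeZero l := ⟨by rintro rfl; exact (Nat.not_odd_zero hl).elim⟩
  have hne : B.grpT.chart₀ (Quotient.out q.1) ≠ 0 := by
    intro h0
    apply q.2
    have hq : q.1 = B.grpT.toAbs (Quotient.out q.1) := (Quotient.out_eq q.1).symm
    rw [hq]
    have : Quotient.out q.1 = B.grpT.zero := by
      apply B.grpT.chart₀.injective
      rw [h0, B.grpT.chart_zero B.grpT.chart₀_mem]
    rw [this]
  set e := B.grpT.chart₀ (Quotient.out q.1) with he
  have hv : e.val ≠ 0 := fun h => hne ((ZMod.val_eq_zero e).mp h)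
  have hsum : e.val + (-e).val = l := by
    rw [ZMod.neg_val, if_neg hne]
    have := ZMod.val_lt e
    omega
  have hlt := ZMod.val_lt e
  obtain ⟨k, hk⟩ := hl
  unfold absLabel
  rw [← he]
  constructor
  · apply le_min <;> omega
  · rcases le_total e.val (-e).val with h | h
    · rw [min_eq_left h]; omega
    · rw [min_eq_right h]; omega

/-- The canonical labelling `T^⋇ ⥲ 𝔽_l^⋇ = {1, …, l^⋇}` (shifted to `Fin l^⋇`) "determined by the
`𝔽_l^±`-group structure of `T`" ([IUTchI] Def 6.4 (i) p. 162; Prop 6.9 (i) p. 169), for `l` odd: it selects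
which poly-morphism `φ^Θ_{v_j}` of Example 4.4 Proposition 6.7 transports to the constituent labelled `j`.
([IUTchI] Def 6.4 (i) p.162) [claim: Mochizuki2012, status: disputed] -/
noncomputable def starLabel (hl : Odd l) (q : B.grpT.AbsStar) : Fin ((l - 1) / 2) :=
  ⟨B.absLabel q.1 - 1, by have := B.absLabel_pos_le hl q; omega⟩

/-- **Prop 6.7 (construction).** "By replacing `†𝔇_T` by `†𝔇_{T^⋇}`, identifying the `𝒟`-prime-strip
`†𝔇_≻` with the `𝒟`-prime-strip `†𝔇_0` via `†φ^{Θ±}_0` to form a `𝒟`-prime-strip `†𝔇_>`, replacing the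
various `+`-full poly-morphisms that occur in `†φ^{Θ±}_±` at the `v ∈ 𝕍^good` by the corresponding full
poly-morphisms, and replacing the various `+`-full poly-morphisms that occur in `†φ^{Θ±}_±` at the
`v ∈ 𝕍^bad` by the poly-morphisms described [via group-theoretic algorithms!] in Example 4.4, (i),
(ii), we obtain a functorial algorithm for constructing a [well-defined, up to a unique isomorphism!]
`𝒟-Θ`-bridge `†φ^Θ_⋇ : †𝔇_{T^⋇} → †𝔇_>`" ([IUTchI] Prop 6.7 p. 167). Here `†𝔇_> := †𝔇_≻`; at bad `v` the
model poly-morphisms are transported along every identification of the constituents with the model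
compatible with the bridge (their union; a single conjugate when the algorithm is well-defined).
([IUTchI] Prop 6.7 p.167) [claim: Mochizuki2012, status: disputed] -/
noncomputable def thetaBridgeData (hl : Odd l) : K.DThetaBridgeData where
  J := ULift B.grpT.AbsStar
  capsule q := B.starCapsule q.down
  codomain := B.codomain
  poly q v :=
    if hv : v ∈ K.bad then
      {h | ∃ (α : K.model v ≅ (B.starCapsule q.down).obj v) (β : K.model v ≅ B.codomain.obj v)
          (_ : ∀ f ∈ B.poly (Quotient.out q.down.1), K.labMap v (α ≪≫ f v ≪≫ β.symm) = Equiv.refl _),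
          ∃ g ∈ M.thetaPolyBad (B.starLabel hl q.down) v hv, h = α.inv ≫ g ≫ β.hom}
    else {h | ∃ f : (B.starCapsule q.down).obj v ≅ B.codomain.obj v, h = f.hom}

/-- "the newly constructed `𝒟-Θ`-bridge is related to the given `𝒟-Θ^±`-bridge via the following
correspondences: `†𝔇_T|_{(T ∖ {0})} ↦ †𝔇_{T^⋇}`; `†𝔇_0, †𝔇_≻ ↦ †𝔇_>` — each of which maps precisely two
`𝒟`-prime-strips to a single `𝒟`-prime-strip" ([IUTchI] Prop 6.7 p. 167): the fibre of `T ∖ {0} → T^⋇`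
over each class is `{t, −t}` with `t ≠ −t` — for `l` odd and `t ≠ 0` in an `𝔽_l^±`-group. PROVED.
([IUTchI] Prop 6.7 p.167) [claim: Mochizuki2012, status: disputed] -/
theorem neg_ne_self_of_ne_zero (hl : Odd l) {t : B.T} (ht : t ≠ B.grpT.zero) : B.grpT.neg t ≠ t := by
  intro h
  apply ht
  apply B.grpT.chart₀.injective
  have h1 := congrArg B.grpT.chart₀ h
  rw [B.grpT.chart_neg B.grpT.chart₀_mem] at h1
  rw [B.grpT.chart_zero B.grpT.chart₀_mem]
  rcases (ZMod.neg_eq_self_iff (B.grpT.chart₀ t)).mp h1 with h0 | h2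
  · exact h0
  · exfalso
    obtain ⟨k, hk⟩ := hl
    omega

/-- **Prop 6.7 (statement)**: the construction `thetaBridgeData` is "a functorial algorithm for
constructing a [well-defined, up to a unique isomorphism!] `𝒟-Θ`-bridge `†φ^Θ_⋇ : †𝔇_{T^⋇} → †𝔇_>` as in
Definition 4.6, (ii)" ([IUTchI] Prop 6.7 p. 167): for the labelling `T^⋇ ⥲ 𝔽_l^⋇` induced by the
`𝔽_l^±`-group structure of `T`, the output satisfies abc-iut-L5-t3's `𝒟-Θ`-bridge condition
`IsDThetaBridge` (Def 4.6 (ii); TODO-merge) — named statement, parametrised by that predicate.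
([IUTchI] Prop 6.7 p.167) [claim: Mochizuki2012, status: disputed] -/
def ThetaBridgeAlgorithm (IsDThetaBridge : K.DThetaBridgeData → Prop) (hl : Odd l) : Prop :=
  ∀ B : K.DThetaPMBridge, IsDThetaBridge (B.thetaBridgeData M hl)

end DThetaPMBridge

/-! ### Proposition 6.8: symmetries arising from forgetful functors -/

namespace DThetaPMEllHT

variable {K}

/-- **Prop 6.8 (i)** (Base-`Θ^{ell}`-bridges): the functor `†ℋ𝒯^{𝒟-Θ±ell} ↦ (†𝔇_T → †𝒟^{⊚±})` to
`𝒟-Θ^{ell}`-bridges has output which "admits an `𝔽_l^{⋊±}`-symmetry — i.e., more precisely, a symmetry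
given by the action of a finite group that is equipped with a natural outer isomorphism to `𝔽_l^{⋊±}` —
which acts doubly transitively [i.e., transitively with stabilizers of order two] on the index set
[i.e., `T`] of the underlying capsule of `𝒟`-prime-strips" ([IUTchI] Prop 6.8 (i) pp. 167–168).
Rendered: the automorphisms of the underlying `𝒟-Θ^{ell}`-bridge act transitively on `T` through their
index bijections, and there are `2 · |T|` of them (guarded by `Nonempty 𝕍`, cf. `PMBaseBridgeProps`). ([IUTchI] Prop 6.8 (i) p.167) [claim: Mochizuki2012, status: disputed] -/
def EllBridgeSymmetry (H : K.DThetaPMEllHT) : Prop :=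
  Nonempty K.V → (∀ t₁ t₂ : H.T, ∃ g : DThetaEllBridge.Iso H.ellBridge H.ellBridge, g.indexEquiv t₁ = t₂) ∧
    Nat.card (DThetaEllBridge.Iso H.ellBridge H.ellBridge) = 2 * Nat.card H.T

/-- Any two `𝒟`-prime-strips are isomorphic (all constituents are isomorphs of the models), the fact
underlying the `𝔖_{l^±}`-symmetry of Prop 6.8 (ii). ([IUTchI] Prop 6.8 (ii) p.168) [claim: Mochizuki2012, status: disputed] -/
theorem nonempty_iso (D₁ D₂ : K.DStrip) : Nonempty (D₁.Iso D₂) :=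
  ⟨fun v => (D₁.isLocal v).some ≪≫ (D₂.isLocal v).some.symm⟩

/-- **Prop 6.8 (ii)** (Holomorphic Capsules): the functor `†ℋ𝒯^{𝒟-Θ±ell} ↦ †𝔇_{|T|}` to "`l^±`-capsules
of `𝒟`-prime-strips and capsule-full poly-isomorphisms" has output which "admits an
`𝔖_{l^±}`-symmetry which acts transitively on the index set [i.e., `|T|`] … this functor may be thought
of as an operation that consists of forgetting the labels `∈ |𝔽_l|` … if one is only given this output
data `†𝔇_{|T|}` up to isomorphism, then there is a total of precisely `l^±` possibilities for the element
`∈ |𝔽_l|` to which a given index `|t| ∈ |T|` corresponds" ([IUTchI] Prop 6.8 (ii) p. 168). Rendered and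
PROVED: every permutation `σ` of `|T|` underlies a capsule-full poly-automorphism of `†𝔇_{|T|}` (there
are isomorphisms `†𝔇_q ⥲ †𝔇_{σ q}` for all `q`). ([IUTchI] Prop 6.8 (ii) p.168) [claim: Mochizuki2012, status: disputed] -/
theorem absCapsule_symmetry (H : K.DThetaPMEllHT) (σ : Equiv.Perm H.grpT.Abs) :
    ∀ q, Nonempty ((H.pmBridge.absCapsule q).Iso (H.pmBridge.absCapsule (σ q))) :=
  fun _ => nonempty_iso _ _

/-- **Prop 6.8 (iii)** (Mono-analytic Capsules): composing (ii) with mono-analyticization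
`†ℋ𝒯^{𝒟-Θ±ell} ↦ †𝔇^⊢_{|T|}` gives output which "satisfies the same symmetry properties with respect to
labels as the output data of the functor of (ii)" ([IUTchI] Prop 6.8 (iii) p. 168). PROVED over the
§4 interface: every permutation of `|T|` underlies a capsule-full poly-automorphism of `†𝔇^⊢_{|T|}`.
([IUTchI] Prop 6.8 (iii) p.168) [claim: Mochizuki2012, status: disputed] -/
theorem monoAbsCapsule_symmetry (M : K.MultKit) (H : K.DThetaPMEllHT) (σ : Equiv.Perm H.grpT.Abs) :
    ∀ q, Nonempty (M.mono (H.pmBridge.absCapsule q) ⟶ M.mono (H.pmBridge.absCapsule (σ q))) :=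
  fun _ => ⟨M.monoMap (nonempty_iso _ _).some⟩

end DThetaPMEllHT

/-! ### Proposition 6.9: processions of base-prime-strips -/

namespace DThetaPMBridge

variable {K} (B : K.DThetaPMBridge)

/-- **Prop 6.9 (i)** (Holomorphic Processions): "`Prc(†𝔇_T)` the `l^±`-procession of `𝒟`-prime-strips
determined by considering the [“sub”]capsules of the capsule `†𝔇_{|T|}` corresponding to the subsets
`S^±_1 ⊆ … ⊆ S^±_t := {0, 1, 2, …, t−1} ⊆ … ⊆ S^±_{l^±} = |𝔽_l|`, relative to the bijection
`|T| ⥲ |𝔽_l|`" ([IUTchI] Prop 6.9 (i) p. 169; processions = [IUTchI] Def 4.10 p. 119,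
TODO-merge:abc-iut-L5-t3): the `n`-th capsule of the procession, `n = 1, …, l^±`, as the sub-capsule of
`†𝔇_{|T|}` on the classes with label `< n`. ([IUTchI] Prop 6.9 (i) p.169) [claim: Mochizuki2012, status: disputed] -/
noncomputable def procession (n : ℕ) : K.DCapsule {q : B.grpT.Abs // B.absLabel q < n} :=
  fun q => B.absCapsule q.1

/-- The processions are nested: `S^±_n ⊆ S^±_m` for `n ≤ m` ([IUTchI] Prop 6.9 (i) p. 169).
([IUTchI] Prop 6.9 (i) p.169) [claim: Mochizuki2012, status: disputed] -/
def processionIncl {n m : ℕ} (h : n ≤ m) :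
    {q : B.grpT.Abs // B.absLabel q < n} → {q : B.grpT.Abs // B.absLabel q < m} :=
  fun q => ⟨q.1, lt_of_lt_of_le q.2 h⟩

/-- On the nested index sets the procession capsules literally agree ([IUTchI] Prop 6.9 (i) p. 169).
([IUTchI] Prop 6.9 (i) p.169) [claim: Mochizuki2012, status: disputed] -/
theorem procession_incl {n m : ℕ} (h : n ≤ m) (q : {q : B.grpT.Abs // B.absLabel q < n}) :
    B.procession m (B.processionIncl h q) = B.procession n q := rfl

/-- **Prop 6.9 (i), the count**: "for each `n ∈ {1, …, l^±}`, there are precisely `n` possibilities for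
the element `∈ |𝔽_l|` to which a given index of the index set of the `n`-capsule that appears in the
procession … corresponds … by taking the product, over elements of `|𝔽_l|`, of cardinalities of 'sets
of possibilities', one concludes that by considering processions the indeterminacy consisting of
`(l^±)^{(l^±)}` possibilities that arises in Proposition 6.8, (ii), is reduced to an indeterminacy
consisting of a total of `l^±!` possibilities" ([IUTchI] Prop 6.9 (i) p. 169) — the arithmetic:
`∏_{n=1}^{l^±} n = (l^±)!` and `(l^±)! ≤ (l^±)^{l^±}`. PROVED. ([IUTchI] Prop 6.9 (i) p.169) [claim: Mochizuki2012, status: disputed] -/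
theorem procession_count (m : ℕ) :
    (Finset.range m).prod (fun n => n + 1) = Nat.factorial m ∧ Nat.factorial m ≤ m ^ m :=
  ⟨Finset.prod_range_add_one_eq_factorial m, Nat.factorial_le_pow m⟩

/-- **Prop 6.9 (ii)** (Mono-analytic Processions): "by composing the functor of (i) with the
mono-analyticization operation … one obtains a natural functor `†φ^{Θ±}_± ↦ Prc(†𝔇^⊢_T)` whose output data
satisfies the same indeterminacy properties with respect to labels as the output data of the functor
of (i)" ([IUTchI] Prop 6.9 (ii) pp. 169–170): the mono-analyticized procession over the §4 interface.
([IUTchI] Prop 6.9 (ii) p.169) [claim: Mochizuki2012, status: disputed] -/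
noncomputable def monoProcession (M : K.MultKit) (n : ℕ) : {q : B.grpT.Abs // B.absLabel q < n} → M.DMono :=
  fun q => M.mono (B.procession n q)

end DThetaPMBridge

/-! ### Corollary 6.10: étale-pictures of base-`Θ^{±ell}`-Hodge theaters -/

namespace DThetaPMEllHT

variable {K} (M : K.MultKit)

/-- The `𝒟^⊢`-prime-strip `†𝔇^⊢_>`: "the mono-analyticization `†𝔇^⊢_>` of the `𝒟`-prime-strip `†𝔇_>`
associated, via the functorial algorithm of Proposition 6.7, to the underlying `𝒟-Θ^±`-bridge of
`†ℋ𝒯^{𝒟-Θ±ell}`" ([IUTchI] Cor 6.10 (i) p. 170); `†𝔇_> = †𝔇_≻` (identified with `†𝔇_0` via `†φ^{Θ±}_0`,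
Prop 6.7). ([IUTchI] Cor 6.10 (i) p.170) [claim: Mochizuki2012, status: disputed] -/
def monoCore (H : K.DThetaPMEllHT) : M.DMono := M.mono H.codomain

/-- **Cor 6.10 (i)**: the **`𝒟-Θ^{±ell}`-link** `†ℋ𝒯^{𝒟-Θ±ell} ⟶^𝒟 ‡ℋ𝒯^{𝒟-Θ±ell}` "from `†ℋ𝒯^{𝒟-Θ±ell}` to
`‡ℋ𝒯^{𝒟-Θ±ell}`" is "the full poly-isomorphism `†𝔇^⊢_> ⥲ ‡𝔇^⊢_>` between the `𝒟^⊢`-prime-strips obtained by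
applying the functor" `†ℋ𝒯^{𝒟-Θ±ell} ↦ †𝔇_> ↦ †𝔇^⊢_>` ([IUTchI] Cor 6.10 (i) p. 170): the set of all
isomorphisms. ([IUTchI] Cor 6.10 (i) p.170) [claim: Mochizuki2012, status: disputed] -/
def dLink (H₁ H₂ : K.DThetaPMEllHT) : Set (monoCore M H₁ ⟶ monoCore M H₂) := Set.univ

/-- The `𝒟-Θ^{±ell}`-link is a nonempty poly-isomorphism (any two `𝒟`-prime-strips are isomorphic).
PROVED. ([IUTchI] Cor 6.10 (i) p.170) [claim: Mochizuki2012, status: disputed] -/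
theorem dLink_nonempty (H₁ H₂ : K.DThetaPMEllHT) : (dLink M H₁ H₂).Nonempty :=
  ⟨M.monoMap (nonempty_iso _ _).some, trivial⟩

/-- **Cor 6.10 (ii)**: "If `… ⟶^𝒟 ⁽ⁿ⁻¹⁾ℋ𝒯^{𝒟-Θ±ell} ⟶^𝒟 ⁿℋ𝒯^{𝒟-Θ±ell} ⟶^𝒟 ⁽ⁿ⁺¹⁾ℋ𝒯^{𝒟-Θ±ell} ⟶^𝒟 …` [where
`n ∈ ℤ`] is an infinite chain of `𝒟-Θ^{±ell}`-linked `𝒟-Θ^{±ell}`-Hodge theaters …, then we obtain a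
resulting chain of full poly-isomorphisms `… ⥲ ⁿ𝔇^⊢_> ⥲ ⁽ⁿ⁺¹⁾𝔇^⊢_> ⥲ …` … That is to say, the output data of
the functor of (i) forms a constant invariant … — i.e., a mono-analytic core — of the above infinite
chain" ([IUTchI] Cor 6.10 (ii) p. 171). Rendered and PROVED: along any `ℤ`-indexed chain, the
composite of the links from `n` to `m` and from `m` to `k` is again the (full) link from `n` to `k`.
([IUTchI] Cor 6.10 (ii) p.171) [claim: Mochizuki2012, status: disputed] -/
theorem chain_constant_invariant (chain : ℤ → K.DThetaPMEllHT) (n m k : ℤ) :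
    {h | ∃ f ∈ dLink M (chain n) (chain m), ∃ g ∈ dLink M (chain m) (chain k), h = f ≫ g} =
      dLink M (chain n) (chain k) := by
  ext h
  simp only [dLink, Set.mem_univ, true_and, Set.mem_setOf_eq, iff_true]
  obtain ⟨f, -⟩ := dLink_nonempty M (chain n) (chain m)
  exact ⟨f, Groupoid.inv f ≫ h, by simp⟩

/-- **Cor 6.10 (iii)**: an **étale-picture of `𝒟-Θ^{±ell}`-Hodge theaters**: "If we regard each of the
`𝒟-Θ^{±ell}`-Hodge theaters of the chain of (ii) as a spoke emanating from the mono-analytic core …, then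
we obtain a diagram — i.e., an étale-picture … `>^⊢` denotes the mono-analytic core, obtained by
identifying the mono-analyticized `𝒟`-prime-strips of the `𝒟-Θ^{±ell}`-Hodge theater labeled `0` and
`≻` … the coric `𝒟^⊢`-prime-strip `>^⊢` may be thought of as being equipped with various distinct
'holomorphic structures'" ([IUTchI] Cor 6.10 (iii) pp. 171–172): a family of spokes indexed by a set
`I`, a core `𝒟^⊢`-prime-strip, and for each spoke the full poly-isomorphism from its `†𝔇^⊢_>` to the
core. ([IUTchI] Cor 6.10 (iii) p.171) [claim: Mochizuki2012, status: disputed] -/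
structure EtalePicture (I : Type) where
  /-- the spokes -/
  spoke : I → K.DThetaPMEllHT
  /-- the mono-analytic core `>^⊢` -/
  core : M.DMono
  /-- each spoke is attached to the core by the full poly-isomorphism `ⁱ𝔇^⊢_> ⥲ >^⊢` -/
  attach : ∀ i, Set (monoCore M (spoke i) ⟶ core)
  /-- the attaching poly-morphisms are full -/
  attach_full : ∀ i, attach i = Set.univ

/-- **Cor 6.10 (iii), symmetries**: "this diagram satisfies the important property of admitting
arbitrary permutation symmetries among the spokes [i.e., among the labels `n ∈ ℤ` of the
`𝒟-Θ^{±ell}`-Hodge theaters]" ([IUTchI] Cor 6.10 (iii) p. 172): relabelling the spokes along any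
permutation of `I` yields an étale-picture with the same core and the same attaching poly-morphisms.
([IUTchI] Cor 6.10 (iii) p.172) [claim: Mochizuki2012, status: disputed] -/
def EtalePicture.permute {I : Type} (E : EtalePicture M I) (σ : Equiv.Perm I) : EtalePicture M I where
  spoke := E.spoke ∘ σ
  core := E.core
  attach i := E.attach (σ i)
  attach_full i := E.attach_full (σ i)

/-- Permuting the spokes does not change the core ([IUTchI] Cor 6.10 (iii) p. 172). PROVED
(definitional). ([IUTchI] Cor 6.10 (iii) p.172) [claim: Mochizuki2012, status: disputed] -/
theorem EtalePicture.permute_core {I : Type} (E : EtalePicture M I) (σ : Equiv.Perm I) :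
    (E.permute M σ).core = E.core := rfl

end DThetaPMEllHT

/-! ### Proposition 6.9 (iii) and Corollary 6.10 (iv): compatibility with §4 (parametrised) -/

/-- **Prop 6.9 (iii)**: "The functors of (i), (ii) are compatible, respectively, with the functors of
Proposition 4.11, (i), (ii), relative to the functor [i.e., determined by the functorial algorithm] of
Proposition 6.7, in the sense that the natural inclusions `S^⋇_j = {1, …, j} ↪ S^±_t = {0, 1, …, t−1}` —
where `j ∈ {1, …, l^⋇}` and `t := j + 1` — determine natural transformations
`†φ^{Θ±}_± ↦ (Prc(†𝔇_{T^⋇}) ↪ Prc(†𝔇_T))`, `†φ^{Θ±}_± ↦ (Prc(†𝔇^⊢_{T^⋇}) ↪ Prc(†𝔇^⊢_T))`" ([IUTchI] Prop 6.9 (iii)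
p. 170). Rendered over abc-iut-L5-t3's procession functor of Prop 4.11 (i) as a parameter `prc4`
(the `j`-capsule of `Prc(†𝔇_{T^⋇})` as a capsule indexed by classes of nonzero label `≤ j`): each of its
constituents is literally the corresponding constituent of the `(j+1)`-capsule of `Prc(†𝔇_T)` — named
statement. ([IUTchI] Prop 6.9 (iii) p.170) [claim: Mochizuki2012, status: disputed] -/
def DThetaPMBridge.ProcessionCompat (B : K.DThetaPMBridge)
    (prc4 : ∀ j : ℕ, K.DCapsule {q : B.grpT.AbsStar // B.absLabel q.1 ≤ j}) : Prop :=
  ∀ (j : ℕ) (q : {q : B.grpT.AbsStar // B.absLabel q.1 ≤ j}),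
    prc4 j q = B.procession (j + 1) ⟨q.1.1, Nat.lt_succ_of_le q.2⟩

/-- **Cor 6.10 (iv)**: "The constructions of (i), (ii), (iii) are compatible, respectively, with the
constructions of Corollary 4.12, (i), (ii), (iii), relative to the functor [i.e., determined by the
functorial algorithm] of Proposition 6.7, in the evident sense" ([IUTchI] Cor 6.10 (iv) p. 172).
Rendered over abc-iut-L5-t3's Cor 4.12 (i) functor `†ℋ𝒯^{𝒟-ΘNF} ↦ †𝔇^⊢_>` as a parameter `core4` on the
`𝒟-Θ`-bridge data produced by Prop 6.7: the two mono-analytic cores agree — named statement.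
([IUTchI] Cor 6.10 (iv) p.172) [claim: Mochizuki2012, status: disputed] -/
def DThetaPMEllHT.CoreCompat (M : K.MultKit) (core4 : K.DThetaBridgeData → M.DMono) (hl : Odd l) : Prop :=
  ∀ H : K.DThetaPMEllHT, core4 (H.pmBridge.thetaBridgeData M hl) = DThetaPMEllHT.monoCore M H

/-! ### Consistency: a model of `MultKit` over the toy base kit -/

/-- A model of the §4-input kit over `PMBaseKit.toyKit` (prime `l ≠ 2`): one-object groupoid of
`𝒟^⊢`-prime-strips, trivial isomorphisms, empty bad-place poly-morphisms — witnessing that `MultKit`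
has honest inhabitants ([IUTchI] Def 4.1 (iv) p. 96). ([IUTchI] Def 4.1 (iv) p.96) [claim: Mochizuki2012, status: disputed] -/
noncomputable def MultKit.toy (l : ℕ) [Fact l.Prime] (hl : l ≠ 2) : (toyKit l hl).MultKit where
  DMono := SingleObj Unit
  mono _ := SingleObj.star _
  monoMap _ := 𝟙 _
  thetaPolyBad _ _ _ := ∅

end PMBaseKit

end Literature.IUT.HodgeTheaters
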